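import Summits.BirchSwinnertonDyer.BirchSwinnertonDyer.Theorems.ClassRecordThreeHsiehDescentTateSen
import Summits.BirchSwinnertonDyer.BirchSwinnertonDyer.Theses.ClassRecordThree
import HarnessLib

/-!
# Route `ClassRecordThree`, crux `HsiehDescentAtThree` (item stmt-BirchSwinnertonDyer-19108) — PART 2 of 2:
# `Three.HsiehDescentAt₃ W` from exact value reciprocity on `G_{ℚ₃(μ_m)}` (K5-B) and the printed Tate–Sen theorem

Cell `bsd-stepL` (run/shared/lean/pub/bsd-stepL/), seat `bsd-stepL-bdp` (prover g9; kernel text = g4's HOME file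
`bdp/K4ter_Proof.lean` v3 §§2, 5 = K4⁗′, re-checked rc 0 on 2026-08-26 and re-cut for the tree under D-0059 ∕ D-0071),
`--supports stmt-BirchSwinnertonDyer-19108`. Sequel of `ClassRecordThreeHsiehDescentTateSen` (the named fact
`TateSenCharacterVanishing` and the vanishing of the twist exponent on inertia).

H1@3 (the Λ^ur-integral, CJM18-normalised BDP element at `3 ∥ N`) is MEMO-PROVED in the cell (PROOF-BDP Thm A,
referee PASS ×2) and carried in the kernel by x11b3's ladder K1–K4″ up to ONE labelled hypothesis (VR_loc|κ) =
(VR-A_𝔭)|κ ∧ (VR-B_I)|κ of `Three.hsiehDescentAt₃_of_rangeValueReciprocity`; TARGET.md v1.33 §1.1 records the kernel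
price {Tate–Sen for a character in its printed shape + K5-B}, which this file lands: the A-half is REMOVED, the
Galois input is the printed theorem, the B-half is taken in the open-subgroup shape the printed CM theorems deliver.

* `hsiehDescentAt₃_of_openValueReciprocity_of_tateSenCharacter` (K4⁗′): `TateSenCharacterVanishing 3 → (VR-B_U)|κ →
  Three.HsiehDescentAt₃ W`.
* `classRecordThree_hsiehDescentAtThree_of_tateSenCharacter_of_openValueReciprocity`: the route item
  `Theses.ClassRecordThree.HsiehDescentAtThree` from the same two inputs (for every `W`, hence on both loci).

HONEST FRAMING: CONDITIONAL (two hypotheses: a printed theorem as a named fact, and K5-B — print-DERIVED from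
[T1] Brooks IMRN 2015 Prop. 8.7 ∕ BDP13 Thm. 5.5 + [T2] Hida–Tilouine 1993 Thm. 1.1 ∕ Katz 1978 (2.4.5), assembled
nowhere as one statement, hence NOT a Literature fact and NOT discharged; its kernel form needs the CM-test-triple ∕
algebraic-Θ^j definition front, x11b3 L72 ∕ ruling (R-b)). The item stays OPEN; no node, no census word changes (T7).
What this is NOT: not H1@3 unconditionally; not K5-B; not a statement at `p ≥ 5`.
References: [Hsieh2014] Thm. 1; [CastellaHsieh2018] Def. 3.5, Prop. 3.6; [BrinonConrad2009] Thm. 2.2.7; [Tate1967] §3.3 Thm. 2;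
tree `X11b/Three/HsiehDescentOfRangeReciprocity.lean` (K4″); cell memo PROOF-BDP §18 (3), §19.
-/

noncomputable section

open scoped NumberField Topology
open Filter NumberField IsDedekindDomain Field PowerSeries WeierstrassCurve
open Literature.NumberTheory.GaloisRepresentations Literature.NumberTheory.EllipticCurves
open Literature.NumberTheory.EllipticCurves.ModularForms
open Summit.BirchSwinnertonDyer.Rank1Residual Summit.BirchSwinnertonDyer.Rank1Residual.X11b
open Summit.BirchSwinnertonDyer.Rank1Residual.X11b.Three
open Summit.BirchSwinnertonDyer.Rank1Residual.X11b.LambdaSupply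
open Summit.BirchSwinnertonDyer.Rank1Residual.X11b.Three.LambdaSupply
open Summit.BirchSwinnertonDyer.Rank1Residual.X11b.PadicComplexTransport (continuous_algEquiv
  mem_unrIntegers_of_forall_inertia_fixed_family mem_fracUnr_of_forall_inertia_fixed_family)
open Summit.BirchSwinnertonDyer.Rank1Residual.X11b.Three.RangeTransport
open Literature.NumberTheory.PAdicHodge (TateSenCharacterVanishing)

namespace Summit.BirchSwinnertonDyer.BirchSwinnertonDyer.Theorems

/-! ### §3 The core: `HsiehDescentAt₃ W` from exact value reciprocity on `G_{ℚ₃(μ_m)}` and the printed Tate–Sen theorem -/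

section Core

variable (W : WeierstrassCurve ℚ) [W.IsElliptic]

/-- **K4⁗′ (PROOF-BDP §18 (3), §19.10): `Three.HsiehDescentAt₃ W` from the B-half (VR-B_U)|κ ALONE and the PRINTED
Tate–Sen theorem.** The hypothesis `hVRBU` is the tree's K4″ hypothesis `hVRlocκ`
(`Three.hsiehDescentAt₃_of_rangeValueReciprocity`, `X11b/Three/HsiehDescentOfRangeReciprocity.lean`) with the
(VR-A_𝔭)|κ conjunct DELETED and the inertial clause widened to EXACT value reciprocity for every `τ` in
the OPEN subgroup `G_{ℚ₃(μ_m)} = {τ | τ fixes μ_m}` (some `m ≥ 1`, `3 ∤ m`), on the κ-range — the shape the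
print-derived B-half has ([T1]+[T2]: exactness for `σ ∈ Aut(ℂ/H(i))`, `H(i)` unramified above `3`; = K5-B, NOT
discharged here); `hTS` is the named fact `TateSenCharacterVanishing 3`. PROOF = K4″'s ten steps with step 5 replaced: for `τ ∈ G_F` the exact reciprocity in
family form gives `T_τ Ē = B_{a′(τ)} Ē` (`exists_twist_of_family` with `c = d = 1`, `e = 0`), off `G_F` put
`a′ := 0`; `twistExponent_eq_zero_on_inertia_of_tateSenCharacter` kills `a′` on inertia, so `T_τ Ē = Ē` for inertial
`τ` (step 6); steps 7–10 verbatim. K4″'s A-half served only K3's cyclotomic `hSen`, whence the Tate–Sen input. CONDITIONAL on `hTS` (printed theorem, named fact) and `hVRBU` (K5-B); the node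
`Three.HsiehDescentAt₃` and K4″ are untouched. [cite: Hsieh2014, Thm. 1 (arXiv:1112.1580 pp. 3–4)]
[cite: CastellaHsieh2018, Def. 3.5 and Prop. 3.6] [cite: BrinonConrad2009, Thm. 2.2.7] -/
theorem hsiehDescentAt₃_of_openValueReciprocity_of_tateSenCharacter
    (hTS : TateSenCharacterVanishing 3)
    (hVRBU :
  ∀ (ι' : PadicAlgCl 3 ≃+* ℂ) (K : Type) [Field K] [NumberField K] (𝔭 : HeightOneSpectrum (𝓞 K))
      (κ : ZpExtension K 3) {N : ℕ} [NeZero N] (f : CuspForm (CongruenceSubgroup.Gamma0 N) 2),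
      IsNewformOf W f → W.conductorNorm ℤ = N → IsImaginaryQuadratic K → SatisfiesHeegnerHypothesis N K →
      ((Ideal.span {(3 : ℤ)}).primesOver (𝓞 K)).ncard = 2 → ((3 : ℕ) : 𝓞 K) ∈ 𝔭.asIdeal →
      𝔭.asIdeal.ramificationIdx (𝓞 ℚ) = 1 → 𝔭.asIdeal.inertiaDeg (𝓞 ℚ) = 1 →
      (∀ (w : InfinitePlace K) (k : 𝓞 K), k ∈ 𝔭.asIdeal ↔ ‖ι'.symm (w.embedding (k : K))‖ < 1) →
      κ.IsAnticyclotomic →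
      ∃ Ω : ℂ, Ω ≠ 0 ∧ ∃ m : ℕ, 0 < m ∧ ¬ 3 ∣ m ∧
        -- (VR-B_U)|κ: EXACT value reciprocity for every `τ` fixing `μ_m`, on the κ-RANGE
        (∀ (τ : PadicAlgCl 3 ≃ₐ[ℚ_[3]] PadicAlgCl 3) (σ : ℂ ≃ₐ[ℚ] ℂ),
          (∀ ζ : PadicAlgCl 3, ζ ^ m = 1 → τ ζ = ζ) →
          (∀ z : PadicAlgCl 3, σ (ι' z) = ι' (τ z)) →
          ∀ (χ : HeckeCharacter K) (n : ℕ), 0 < n →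
            (∀ v : HeightOneSpectrum (𝓞 K), χ.IsUnramifiedAt v) →
            ∀ hχ : χ.HasInfinityType (fun _ ↦ (n : ℤ)) (fun _ ↦ -(n : ℤ)),
              ∀ r : FramedGaloisRep K (PadicAlgCl 3) 1, IsPAdicAvatarOf ι' χ r → FactorsThroughZp κ r →
                σ (bdpInterpolationValue 3 f 𝔭 χ n Ω) =
                  bdpInterpolationValue 3 f 𝔭 (hχ.autConj σ) n Ω)) :
    HsiehDescentAt₃ W := by
  intro ι' K _ _ 𝔭 κ γ N _ f hf hX hSurj hN hKiq hodd hHeeg hsplit h3𝔭 hram hdeg hι𝔭 hℓ hκa hγ A ΩK C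
    Ωp Q hA hΩK hC hΩp hQ
  haveI : IsNonarchimedeanLocalField ℚ_[3] :=
    Literature.NumberTheory.GaloisRepresentations.Padic.isNonarchimedeanLocalField_holds 3
  have h3N : 3 ∣ N := hN ▸ dvd_conductorNorm_of_mult hX.2.2.1
  obtain ⟨Ω, hΩ, m, hm, h3m, hVRB⟩ := hVRBU ι' K 𝔭 κ f hf hN hKiq hHeeg hsplit h3𝔭 hram hdeg hι𝔭 hκa
  -- the open subgroup `G_F = {τ | τ fixes μ_m}` ⊇ inertia
  set P : (PadicAlgCl 3 ≃ₐ[ℚ_[3]] PadicAlgCl 3) → Prop := fun τ ↦ ∀ ζ : PadicAlgCl 3, ζ ^ m = 1 → τ ζ = ζ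
    with hPdef
  have hPI : ∀ τ : PadicAlgCl 3 ≃ₐ[ℚ_[3]] PadicAlgCl 3,
      (∀ ζ : PadicAlgCl 3, (∃ k : ℕ, 0 < k ∧ ¬ 3 ∣ k ∧ ζ ^ k = 1) → τ ζ = ζ) → P τ :=
    fun τ hτ ζ hζ ↦ hτ ζ ⟨m, hm, h3m, hζ⟩
  change ∀ τ σ, P τ → _ at hVRB
  have hKreal : ∀ w : InfinitePlace K, ¬ w.IsReal := not_isReal_of_isImaginaryQuadratic hKiq
  have hK2 : Module.finrank ℚ K = 2 := hKiq.1
  set CC : ℂ_[3] := ((ι'.symm C : PadicAlgCl 3) : ℂ_[3]) with hCC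
  have hCC0 : CC ≠ 0 := fun h ↦ by rw [h, norm_zero] at hC; exact zero_ne_one hC
  have hA' : (A : ℂ) ≠ 0 := by exact_mod_cast hA.ne'
  have hΘ0 : ((((3 : ℕ) : ℂ) / (16 * (A : ℂ) ^ 2)) * (Ω / ΩK) ^ 4) ≠ 0 :=
    mul_ne_zero (div_ne_zero (by norm_num) (mul_ne_zero (by norm_num) (pow_ne_zero 2 hA')))
      (pow_ne_zero 4 (div_ne_zero hΩ hΩK))
  set θ : ℂ_[3] := ((ι'.symm ((((3 : ℕ) : ℂ) / (16 * (A : ℂ) ^ 2)) * (Ω / ΩK) ^ 4) : PadicAlgCl 3) :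
    ℂ_[3]) * Ωp ^ 4 with hθ
  have hΩp0 : Ωp ≠ 0 := fun h ↦ by rw [h, norm_zero] at hΩp; exact zero_ne_one hΩp
  have hθ0 : θ ≠ 0 := by
    refine mul_ne_zero ?_ (pow_ne_zero 4 hΩp0)
    rw [PadicComplex.coe_eq, map_ne_zero_iff _ (algebraMap (PadicAlgCl 3) ℂ_[3]).injective,
      map_ne_zero_iff _ ι'.symm.injective]
    exact hΘ0
  -- ## 1. The extensions `T_τ`, their coefficient maps, and `σ_τ = ι′ τ ι′⁻¹`
  choose T hT hTτ using fun τ : PadicAlgCl 3 ≃ₐ[ℚ_[3]] PadicAlgCl 3 ↦ exists_continuous_extension τ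
  choose φ hφ using fun τ : PadicAlgCl 3 ≃ₐ[ℚ_[3]] PadicAlgCl 3 ↦
    exists_restrict_padicComplexInt (hT τ) (hTτ τ)
  have hσex : ∀ τ : PadicAlgCl 3 ≃ₐ[ℚ_[3]] PadicAlgCl 3, ∃ σ : ℂ ≃ₐ[ℚ] ℂ,
      ∀ z, σ (ι' z) = ι' (τ z) := fun τ ↦ by
    obtain ⟨σ, hσ⟩ := exists_algEquiv_eq_ringEquiv
      (ι'.symm.trans ((τ : PadicAlgCl 3 ≃+* PadicAlgCl 3).trans ι'))
    exact ⟨σ, fun z ↦ by rw [hσ]; simp⟩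
  choose σ hστ using hσex
  have hσK : ∀ τ (φ' : K →+* ℂ) (k : K), σ τ (φ' k) = φ' k := by
    intro τ φ' k
    have h1 := algEquiv_apply_embedding_eq hK2 (embAt K 3 𝔭 h3𝔭 hram hdeg) τ
      (ι'.symm.toRingHom.comp φ') k
    have h2 := hστ τ (ι'.symm (φ' k))
    rw [ι'.apply_symm_apply] at h2
    rw [h2]
    change ι' (τ (ι'.symm (φ' k))) = φ' k
    rw [show τ (ι'.symm (φ' k)) = ι'.symm (φ' k) from h1, ι'.apply_symm_apply]
  -- ## 2. A base range point with `‖u − 1‖ < 1/3`, `u ≠ 1`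
  obtain ⟨χ₀, m₀, ψ₀, hm₀, hunr₀, hχ₀, hav₀, hfac₀, hlt₀, hne₀⟩ :=
    exists_interpolationCharacter (p := 3) (by norm_num) ι' K κ hKiq hκa γ hγ
  rw [avatarValueAt_unitsChar] at hlt₀
  simp_rw [avatarValueAt_unitsChar] at hne₀
  obtain ⟨k, hk⟩ : ∃ k : ℕ,
      ‖(((ψ₀ γ : (PadicAlgCl 3)ˣ) : PadicAlgCl 3) : ℂ_[3]) ^ 3 ^ k - 1‖ < ((3 : ℕ) : ℝ)⁻¹ := by
    have ht := (tendsto_pow_prime_pow_padicComplex (p := 3) hlt₀).sub_const 1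
    rw [sub_self] at ht
    have hev := (Metric.tendsto_nhds.1 ht) _ (by positivity : (0 : ℝ) < ((3 : ℕ) : ℝ)⁻¹)
    obtain ⟨k, hk⟩ := hev.exists
    exact ⟨k, by simpa only [dist_zero_right] using hk⟩
  have hn₁ : 0 < 3 ^ k * m₀ := Nat.mul_pos (pow_pos (by norm_num) k) hm₀
  have hunr₁ : ∀ v : HeightOneSpectrum (𝓞 K), (χ₀ ^ 3 ^ k).IsUnramifiedAt v :=
    fun v ↦ isUnramifiedAt_pow' (hunr₀ v) _
  have hχ₁ := hasInfinityType_pow_range hχ₀ (3 ^ k)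
  have hav₁ := isPAdicAvatarOf_pow ι' hav₀ (fun v _ ↦ hunr₀ v) (3 ^ k)
  have hfac₁ := factorsThroughZp_unitsChar_pow κ hfac₀ (3 ^ k)
  have hψ₁γ : (((ψ₀ ^ 3 ^ k) γ : (PadicAlgCl 3)ˣ) : PadicAlgCl 3) =
      ((ψ₀ γ : (PadicAlgCl 3)ˣ) : PadicAlgCl 3) ^ 3 ^ k := by
    rw [ContinuousMonoidHom.pow_apply, Units.val_pow_eq_pow_val]
  have hu : ‖((((ψ₀ ^ 3 ^ k) γ : (PadicAlgCl 3)ˣ) : PadicAlgCl 3) : ℂ_[3]) - 1‖ < ((3 : ℕ) : ℝ)⁻¹ := by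
    rw [hψ₁γ, PadicComplex.coe_eq, map_pow, ← PadicComplex.coe_eq]; exact hk
  have hu1 : (((ψ₀ ^ 3 ^ k) γ : (PadicAlgCl 3)ˣ) : PadicAlgCl 3) ≠ 1 := by
    rw [hψ₁γ]
    intro h
    apply hne₀ k
    rw [PadicComplex.coe_eq, ← map_pow, h, map_one]
  -- ## 3. The degenerate witness `Q = 0`
  by_cases hQ0 : Q = 0
  · refine ⟨ΩK, 1, 0, hΩK, fun χ n hn hunr hχ r hr hκr ↦ ?_⟩
    have hv := hQ χ n hn hunr hχ r hr hκr
    rw [hQ0] at hv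
    have hval := (intSeries_hasValueAt_zero_series (p := 3) (avatarValueAt r γ - 1)).unique hv
    rw [hsiehInterpolationValue_eq_mul_pow_mul h3N f 𝔭 χ n A ΩK C hΩ] at hval
    have hB0 : bdpInterpolationValue 3 f 𝔭 χ n Ω = 0 := by
      have h4n : 4 * n ≠ 0 := by omega
      rcases mul_eq_zero.1 hval.symm with h | h
      · rw [PadicComplex.coe_eq, map_eq_zero_iff _ (algebraMap (PadicAlgCl 3) ℂ_[3]).injective,
          map_eq_zero_iff _ ι'.symm.injective] at h
        rcases mul_eq_zero.1 h with h' | h'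
        · rcases mul_eq_zero.1 h' with h'' | h''
          · exact absurd h'' fun hC0 ↦ hCC0 (by rw [hCC, hC0, map_zero]; rfl)
          · exact absurd h'' (pow_ne_zero n hΘ0)
        · exact h'
      · exact absurd ((pow_eq_zero_iff h4n).1 h) hΩp0
    rw [hsiehInterpolationValue_eq_mul_pow_mul h3N f 𝔭 χ n A ΩK 1 hΩ, hB0, mul_zero, map_zero]
    unfold UnrSeries.HasValueAt
    simp
  -- ## 4. The normalised series `E = ι′⁻¹(C)⁻¹ · Q`
  have hCinv : ‖CC⁻¹‖ ≤ 1 := by rw [norm_inv, hC, inv_one]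
  set c₀ : 𝓞_ℂ_[3] := ⟨CC⁻¹, Literature.NumberTheory.LFunctions.Dwork.mem_unitBall.2 hCinv⟩ with hc₀
  have hc₀c : ((c₀ : 𝓞_ℂ_[3]) : ℂ_[3]) = CC⁻¹ := rfl
  set E : PowerSeries 𝓞_ℂ_[3] := PowerSeries.C c₀ * Q with hEdef
  have hE : ∀ k', ((coeff k' E : 𝓞_ℂ_[3]) : ℂ_[3]) = CC⁻¹ * ((coeff k' Q : 𝓞_ℂ_[3]) : ℂ_[3]) :=
    fun k' ↦ by rw [hEdef, coeff_C_mul, MulMemClass.coe_mul, hc₀c]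
  have hE0 : E ≠ 0 := by
    intro h0
    apply hQ0
    have hc : PowerSeries.C c₀ ≠ 0 := by
      intro h
      have : ((c₀ : 𝓞_ℂ_[3]) : ℂ_[3]) = 0 := by
        have := congrArg constantCoeff h
        rw [constantCoeff_C, map_zero] at this
        rw [this]; rfl
      exact inv_ne_zero hCC0 (hc₀c ▸ this)
    exact (mul_eq_zero.1 h0).resolve_left hc
  -- `E`'s values at range points
  have hEval : ∀ (χ : HeckeCharacter K) (n : ℕ), 0 < n →
      (∀ v : HeightOneSpectrum (𝓞 K), χ.IsUnramifiedAt v) →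
      χ.HasInfinityType (fun _ ↦ (n : ℤ)) (fun _ ↦ -(n : ℤ)) →
      ∀ r : FramedGaloisRep K (PadicAlgCl 3) 1, IsPAdicAvatarOf ι' χ r → FactorsThroughZp κ r →
        IntSeries.HasValueAt E (avatarValueAt r γ - 1)
          (θ ^ n * ((ι'.symm (bdpInterpolationValue 3 f 𝔭 χ n Ω) : PadicAlgCl 3) : ℂ_[3])) := by
    intro χ n hn hunr hχ r hr hκr
    have h := hasValueAt_of_coeff_eq_mul hE (hasValueAt_normalForm ι' hQ h3N hΩ hn hunr hχ hr hκr)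
    rw [← hθ, ← hCC, ← mul_assoc, ← mul_assoc, inv_mul_cancel₀ hCC0, one_mul] at h
    exact h
  -- ## 5′. The twist relations `T_τ Ē = (1+T)^{a′_τ} Ē` for INERTIAL `τ` (B-half in family form)
  have h1 : ((ι'.symm (1 : ℂ) : PadicAlgCl 3) : ℂ_[3]) = 1 := by rw [map_one]; rfl
  have key : ∀ τ, ∃ a' : ℤ_[3], P τ →
      (E.map (PadicComplexInt 3).subtype).map (T τ) =
        PowerSeries.C (1 : ℂ_[3]) *
          ((((binomialSeries ℤ_[3] a').map (R1.toCpInt 3)) * E).map (PadicComplexInt 3).subtype) := by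
    intro τ
    by_cases hτ : P τ
    · have hV1 : ∀ j : ℕ, 0 < j →
          σ τ (bdpInterpolationValue 3 f 𝔭 ((χ₀ ^ 3 ^ k) ^ j) (j * (3 ^ k * m₀)) Ω) =
            1 * 1 ^ (j * (3 ^ k * m₀)) * ((0 : HeightOneSpectrum (𝓞 K) →₀ ℤ).prod
              fun v k' ↦ ((hasInfinityType_pow_range hχ₁ j).autConj (σ τ)).valueAtUniformizer v ^ k') *
              bdpInterpolationValue 3 f 𝔭 ((hasInfinityType_pow_range hχ₁ j).autConj (σ τ))
                (j * (3 ^ k * m₀)) Ω := by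
        intro j hj
        rw [Finsupp.prod_zero_index, hVRB τ (σ τ) hτ (hστ τ) _ _ (Nat.mul_pos hj hn₁)
          (fun v ↦ isUnramifiedAt_pow' (hunr₁ v) j) (hasInfinityType_pow_range hχ₁ j) _
          (isPAdicAvatarOf_pow ι' hav₁ (fun v _ ↦ hunr₁ v) j)
          (factorsThroughZp_unitsChar_pow κ hfac₁ j)]
        ring
      obtain ⟨a', ha'⟩ := exists_twist_of_family ι' hQ h3N hΩ hθ0 hCC0 hKreal (hT τ) (hTτ τ) (hφ τ)
        (hστ τ) (hσK τ) one_ne_zero one_ne_zero hn₁ hunr₁ hχ₁ hV1 hav₁ hfac₁ hu hu1 hE0 hE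
      rw [h1] at ha'
      exact ⟨a', fun _ ↦ ha'⟩
    · exact ⟨0, fun h ↦ absurd h hτ⟩
  choose a ha using key
  have hI : ∀ τ, (∀ ζ : PadicAlgCl 3, (∃ k : ℕ, 0 < k ∧ ¬ 3 ∣ k ∧ ζ ^ k = 1) → τ ζ = ζ) → a τ = 0 :=
    twistExponent_eq_zero_on_inertia_of_tateSenCharacter hTS hm h3m T hT hTτ hE0
      (d := fun _ ↦ (1 : ℂ_[3])) (fun _ ↦ one_ne_zero) ha
  -- ## 6. Exactness on inertia: `T_τ Ē = Ē`
  have hfix : ∀ τ, (∀ ζ : PadicAlgCl 3, (∃ m : ℕ, 0 < m ∧ ¬ 3 ∣ m ∧ ζ ^ m = 1) → τ ζ = ζ) →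
      (E.map (PadicComplexInt 3).subtype).map (T τ) = E.map (PadicComplexInt 3).subtype := by
    intro τ hτ
    rw [ha τ (hPI τ hτ), hI τ hτ, binomialSeries_zero, map_one, one_mul, map_one, one_mul]
  -- ## 7. The coefficients of `E` lie in `R₀`: the series `L`
  have hcoefR : ∀ k', ((coeff k' E : 𝓞_ℂ_[3]) : ℂ_[3]) ∈ unrIntegers 3 := fun k' ↦
    mem_unrIntegers_of_forall_inertia_fixed_family 3 T hT hTτ _
      (R1.norm_coe_padicComplexInt_le_one 3 _) fun τ hτ ↦ by
        have h := congrArg (coeff k') (hfix τ hτ)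
        simpa only [coeff_map, ValuationSubring.subtype_apply] using h
  set L : UnrSeries 3 := PowerSeries.mk fun k' ↦ (⟨_, hcoefR k'⟩ : unrIntegers 3) with hL
  have hLE : ∀ k', ((coeff k' E : 𝓞_ℂ_[3]) : ℂ_[3]) = ((coeff k' L : unrIntegers 3) : ℂ_[3]) :=
    fun k' ↦ by rw [hL, coeff_mk]
  -- ## 8. `(T_τ θ)^n = θ^n` on inertia whenever a value of type `n` is non-zero
  set S : Set ℕ := {n | ∃ (χ : HeckeCharacter K) (r : FramedGaloisRep K (PadicAlgCl 3) 1), 0 < n ∧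
    (∀ v : HeightOneSpectrum (𝓞 K), χ.IsUnramifiedAt v) ∧
    χ.HasInfinityType (fun _ ↦ (n : ℤ)) (fun _ ↦ -(n : ℤ)) ∧ IsPAdicAvatarOf ι' χ r ∧
    FactorsThroughZp κ r ∧ bdpInterpolationValue 3 f 𝔭 χ n Ω ≠ 0} with hS
  have hθS : ∀ τ, (∀ ζ : PadicAlgCl 3, (∃ m : ℕ, 0 < m ∧ ¬ 3 ∣ m ∧ ζ ^ m = 1) → τ ζ = ζ) →
      ∀ n ∈ S, (T τ θ) ^ n = θ ^ n := by
    rintro τ hτ n ⟨χ, r, hn, hunr, hχ, hr, hκr, hB⟩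
    -- `r = e₁ ∘ ψ`
    set e₁ := (FramedRep.unitsContinuousMulEquivOfUnique (Fin 1) (PadicAlgCl 3) :
      (PadicAlgCl 3)ˣ →ₜ* GL (Fin 1) (PadicAlgCl 3)) with he₁
    set ψ : absoluteGaloisGroup K →ₜ* (PadicAlgCl 3)ˣ :=
      ((FramedRep.unitsContinuousMulEquivOfUnique (Fin 1) (PadicAlgCl 3)).symm :
        GL (Fin 1) (PadicAlgCl 3) →ₜ* (PadicAlgCl 3)ˣ).comp r with hψ
    have hre : e₁.comp ψ = r := by rw [he₁, hψ, comp_symm_comp_eq]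
    rw [← hre] at hr hκr
    have hτc : Continuous (τ : PadicAlgCl 3 ≃+* PadicAlgCl 3) := continuous_algEquiv τ
    -- the transported range point and its value
    have hunr' : ∀ v : HeightOneSpectrum (𝓞 K), (hχ.autConj (σ τ)).IsUnramifiedAt v :=
      fun v ↦ (hχ.isUnramifiedAt_autConj_iff (σ τ) v).mpr (hunr v)
    have hinf' := hasInfinityType_autConj_of_forall_apply_eq hχ (σ τ) (hσK τ) hKreal
    have hav' := isPAdicAvatarOf_autConj_unitsChar ι' _ hτc (σ τ) (hστ τ) hχ hr
    have hfac' := factorsThroughZp_map_unitsChar _ hτc κ hκr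
    have hv' := hEval _ n hn hunr' hinf' _ hav' hfac'
    rw [avatarValueAt_map_unitsChar _ hτc ψ γ] at hv'
    -- the value at the original point, moved by `T_τ`
    have hv := hEval χ n hn hunr hχ _ hr hκr
    rw [avatarValueAt_unitsChar] at hv
    have hmoved := hasValueAt_map_extension (hT τ) (hφ τ) hv
    have hEφ : E.map (φ τ) = E := by
      apply map_injective (PadicComplexInt 3).subtype Subtype.coe_injective
      rw [map_map_restrict (hφ τ), hfix τ hτ]
    rw [hEφ, map_sub, map_one, hTτ, map_mul, map_pow,
      extension_coe_symm ι' (hTτ τ) (σ τ) (hστ τ), hVRB τ (σ τ) (hPI τ hτ) (hστ τ) χ n hn hunr hχ _ hr hκr]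
      at hmoved
    have heq := hmoved.unique hv'
    have hB' : ((ι'.symm (bdpInterpolationValue 3 f 𝔭 (hχ.autConj (σ τ)) n Ω) : PadicAlgCl 3) :
        ℂ_[3]) ≠ 0 := by
      rw [← hVRB τ (σ τ) (hPI τ hτ) (hστ τ) χ n hn hunr hχ _ hr hκr, PadicComplex.coe_eq,
        map_ne_zero_iff _ (algebraMap (PadicAlgCl 3) ℂ_[3]).injective,
        map_ne_zero_iff _ ι'.symm.injective, map_ne_zero_iff _ (σ τ).injective]
      exact hB
    exact mul_right_cancel₀ hB' heq
  obtain ⟨g, hgS, hgmem⟩ := exists_nat_generator S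
  have hθg : ∀ τ, (∀ ζ : PadicAlgCl 3, (∃ m : ℕ, 0 < m ∧ ¬ 3 ∣ m ∧ ζ ^ m = 1) → τ ζ = ζ) →
      T τ (θ ^ g) = θ ^ g := fun τ hτ ↦ by
    rw [map_pow]; exact pow_eq_pow_of_forall hθ0 (hθS τ hτ) hgmem
  -- ## 9. The new periods
  obtain ⟨β, r, hr, hr1, hβ0, hβr⟩ : ∃ (β : PadicAlgCl 3) (r : ℂ_[3]), r ∈ unrIntegers 3 ∧ ‖r‖ = 1 ∧
      β ≠ 0 ∧ ∀ n ∈ S, ((β : ℂ_[3]) * r ^ 4) ^ n = θ ^ n := by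
    rcases Nat.eq_zero_or_pos g with hg0 | hgpos
    · refine ⟨1, 1, one_mem _, norm_one, one_ne_zero, fun n hn ↦ ?_⟩
      have := hgS n hn
      rw [hg0, zero_dvd_iff] at this
      rw [this, pow_zero, pow_zero]
    · have hmem := mem_fracUnr_of_forall_inertia_fixed_family 3 T hT hTτ (θ ^ g) (hθg)
      obtain ⟨β, r, hr, hr1, hβr⟩ := exists_period_root
        (UnrUnits.forall_exists_padicAlgCl_mul_pow_of_norm_eq_one) hθ0 hgpos hmem
      have hβ0 : β ≠ 0 := by
        intro h0
        rw [h0, PadicComplex.coe_eq, map_zero, zero_mul, zero_pow hgpos.ne'] at hβr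
        exact pow_ne_zero g hθ0 hβr.symm
      exact ⟨β, r, hr, hr1, hβ0, fun n hn ↦ pow_eq_pow_of_dvd hβr (hgS n hn)⟩
  have hιβ : ι' β ≠ 0 := (map_ne_zero_iff _ ι'.injective).2 hβ0
  obtain ⟨ρ, hρ⟩ := IsAlgClosed.exists_pow_nat_eq (ι' β * (16 * (A : ℂ) ^ 2) / ((3 : ℕ) : ℂ))
    (by norm_num : 0 < 4)
  have hρ0 : ρ ≠ 0 := by
    intro h0
    rw [h0, zero_pow (by norm_num : (4 : ℕ) ≠ 0)] at hρ
    exact (div_ne_zero (mul_ne_zero hιβ (mul_ne_zero (by norm_num) (pow_ne_zero 2 hA')))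
      (by norm_num)) hρ.symm
  have hΘ' : (((3 : ℕ) : ℂ) / (16 * (A : ℂ) ^ 2)) * (Ω / (Ω / ρ)) ^ 4 = ι' β := by
    have h1 : Ω / (Ω / ρ) = ρ := by field_simp
    have h3 : ((3 : ℕ) : ℂ) ≠ 0 := by norm_num
    have h16 : (16 * (A : ℂ) ^ 2) ≠ 0 := mul_ne_zero (by norm_num) (pow_ne_zero 2 hA')
    rw [h1, hρ]
    field_simp
  have hru : IsUnit (⟨r, hr⟩ : unrIntegers 3) := (unrIntegers.isUnit_iff_norm_eq_one _).2 hr1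
  refine ⟨Ω / ρ, hru.unit, L, div_ne_zero hΩ hρ0, fun χ n hn hunr hχ r' hr' hκr' ↦ ?_⟩
  -- ## 10. The display
  rw [← IntSeries.hasValueAt_iff_of_coeff_eq hLE]
  have hv := hEval χ n hn hunr hχ r' hr' hκr'
  have hrr : (((hru.unit : (unrIntegers 3)ˣ) : unrIntegers 3) : ℂ_[3]) = r := by
    rw [IsUnit.unit_spec]
  have htarget : ((ι'.symm (hsiehInterpolationValue 3 f 𝔭 χ n A (Ω / ρ) 1) : PadicAlgCl 3) : ℂ_[3]) *
      (((hru.unit : (unrIntegers 3)ˣ) : unrIntegers 3) : ℂ_[3]) ^ (4 * n) =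
      θ ^ n * ((ι'.symm (bdpInterpolationValue 3 f 𝔭 χ n Ω) : PadicAlgCl 3) : ℂ_[3]) := by
    rw [hsiehInterpolationValue_eq_mul_pow_mul h3N f 𝔭 χ n A (Ω / ρ) 1 hΩ, hΘ', one_mul,
      coe_symm_mul, coe_symm_pow, ι'.symm_apply_apply, hrr]
    by_cases hB : bdpInterpolationValue 3 f 𝔭 χ n Ω = 0
    · rw [hB, map_zero, PadicComplex.coe_zero, mul_zero, zero_mul, mul_zero]
    · have hnS : n ∈ S := ⟨χ, r', hn, hunr, hχ, hr', hκr', hB⟩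
      rw [← hβr n hnS, mul_pow, ← pow_mul]
      ring
  rw [htarget]
  exact hv



end Core

/-! ### §4 The route item's shape: crux `HsiehDescentAtThree` of `ClassRecordThree` modulo the two inputs -/

/-- **Item `stmt-BirchSwinnertonDyer-19108` (crux `HsiehDescentAtThree` of route `ClassRecordThree`) CONDITIONALLY:**
the named descent residual `Three.HsiehDescentAt₃ W` holds on BOTH loci of the item — indeed for every elliptic `W` —
given (i) the printed Tate–Sen theorem `TateSenCharacterVanishing 3` (named fact; Brinon–Conrad Thm 2.2.7) and
(ii) K5-B = exact value reciprocity of `bdpInterpolationValue` on an open subgroup `G_{ℚ₃(μ_m)}`, on the κ-range, for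
every `W` (print-derived from [T1] Brooks 2015 Prop. 8.7 ∕ BDP13 Thm. 5.5 + [T2] Hida–Tilouine 1993 Thm. 1.1 ∕
Katz 1978 (2.4.5); NOT a single printed statement, hence a HYPOTHESIS here, not a fact). This is the kernel price of
H1@3 of record (TARGET.md v1.33 §1.1) in the tree: the item is NOT closed by this theorem (conditional-result).
[cite: BrinonConrad2009, Thm. 2.2.7] [cite: Hsieh2014, Thm. 1 (arXiv:1112.1580 pp. 3–4)] -/
theorem classRecordThree_hsiehDescentAtThree_of_tateSenCharacter_of_openValueReciprocity
    (hTS : TateSenCharacterVanishing 3)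
    (hVRBU : ∀ (W : WeierstrassCurve ℚ) [W.IsElliptic],
  ∀ (ι' : PadicAlgCl 3 ≃+* ℂ) (K : Type) [Field K] [NumberField K] (𝔭 : HeightOneSpectrum (𝓞 K))
      (κ : ZpExtension K 3) {N : ℕ} [NeZero N] (f : CuspForm (CongruenceSubgroup.Gamma0 N) 2),
      IsNewformOf W f → W.conductorNorm ℤ = N → IsImaginaryQuadratic K → SatisfiesHeegnerHypothesis N K →
      ((Ideal.span {(3 : ℤ)}).primesOver (𝓞 K)).ncard = 2 → ((3 : ℕ) : 𝓞 K) ∈ 𝔭.asIdeal →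
      𝔭.asIdeal.ramificationIdx (𝓞 ℚ) = 1 → 𝔭.asIdeal.inertiaDeg (𝓞 ℚ) = 1 →
      (∀ (w : InfinitePlace K) (k : 𝓞 K), k ∈ 𝔭.asIdeal ↔ ‖ι'.symm (w.embedding (k : K))‖ < 1) →
      κ.IsAnticyclotomic →
      ∃ Ω : ℂ, Ω ≠ 0 ∧ ∃ m : ℕ, 0 < m ∧ ¬ 3 ∣ m ∧
        (∀ (τ : PadicAlgCl 3 ≃ₐ[ℚ_[3]] PadicAlgCl 3) (σ : ℂ ≃ₐ[ℚ] ℂ),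
          (∀ ζ : PadicAlgCl 3, ζ ^ m = 1 → τ ζ = ζ) →
          (∀ z : PadicAlgCl 3, σ (ι' z) = ι' (τ z)) →
          ∀ (χ : HeckeCharacter K) (n : ℕ), 0 < n →
            (∀ v : HeightOneSpectrum (𝓞 K), χ.IsUnramifiedAt v) →
            ∀ hχ : χ.HasInfinityType (fun _ ↦ (n : ℤ)) (fun _ ↦ -(n : ℤ)),
              ∀ r : FramedGaloisRep K (PadicAlgCl 3) 1, IsPAdicAvatarOf ι' χ r → FactorsThroughZp κ r →
                σ (bdpInterpolationValue 3 f 𝔭 χ n Ω) =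
                  bdpInterpolationValue 3 f 𝔭 (hχ.autConj σ) n Ω)) :
    Summit.BirchSwinnertonDyer.BirchSwinnertonDyer.Theses.ClassRecordThree.HsiehDescentAtThree := by
  intro W _ _ _
  exact ⟨fun _ _ ↦ hsiehDescentAt₃_of_openValueReciprocity_of_tateSenCharacter W hTS (hVRBU W),
    fun _ _ ↦ hsiehDescentAt₃_of_openValueReciprocity_of_tateSenCharacter W hTS (hVRBU W)⟩

end Summit.BirchSwinnertonDyer.BirchSwinnertonDyer.Theorems

end
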